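import Literature.NumberTheory.ModularForms.LevelOneEigenvalueOrderGenerators
import Literature.NumberTheory.ModularForms.LevelOneEigenformGaloisOrbits
import HarnessLib

/-!
# A level-one eigenform, its Hecke order and its Hecke field are determined by the prime-indexed eigenvalues
# `a_p(f)`, `p ≤ dim S_k(SL₂(ℤ))` (Serre VII §5.4 Cor. 2 + the Sturm/Miller bound)

J.-P. Serre, *A Course in Arithmetic*, Ch. VII §5.4, Cor. 2 (held `book:serre1973-course-arithmetic`, p0087; for a
normalized eigenform): "(b) `a(m)a(n) = a(mn)` if `(m, n) = 1`, (c) `a(p)a(pⁿ) = a(pⁿ⁺¹) + p^{2k−1}a(pⁿ⁻¹)`" — so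
every `a_n` is an integer polynomial in the `a_p`, `p ∣ n`.  Combined with the level-one determination bound
`dim S_k` (`LevelOneEigenvalueOrderGenerators`: `ℤ[{a_n(f)}] = ℤa_1 + ⋯ + ℤa_B`, `K_f = ℚ(a_1, …, a_B)`, and two
eigenforms with the same `a_n`, `n ≤ dim S_k`, coincide — Kilford Prop. 6.2, Edixhoven Thm. 2.5.11, Sturm Thm. 1),
only the PRIME-indexed eigenvalues up to the bound matter:

* §1 `Subring.mem_of_prime_le` — the abstract recursion lemma (any ring `S`): a sequence `a : ℕ → S` with `a(0) = 0`, `a(1) = 1`,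
  `a(mn) = a(m)a(n)` for `(m,n) = 1` and `a(p^{m+2}) = a(p)a(p^{m+1}) − c_p a(p^m)` has `a(n) ∈ R` for all `n ≤ N`
  as soon as `a(p), c_p ∈ R` for the primes `p ≤ N` (`R` any subring).
* §2 ★ **`IsNormalizedCuspEigenform.coeff_mem_of_coeff_prime_le_mem`** (`a_n(f) ∈ ℤ[a_p(f) : p ≤ n prime]`),
  ★ **`coeffOrder_eq_adjoin_primes_le`** (`ℤ[{a_n(f)}] = ℤ[a_p(f) : p prime, p ≤ B]` for `B ≥ dim S_k`),
  ★ **`coeffField_eq_adjoin_primes_le`** (`K_f = ℚ(a_p(f) : p prime, p ≤ B)`).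
* §3 ★ **`IsNormalizedCuspEigenform.eq_of_coeff_prime_eq_le_finrank`**: two normalized level-one eigenforms with
  `a_p(f) = a_p(g)` for the primes `p ≤ dim S_k` are equal (the recursion lemma in `ℂ × ℂ` with the diagonal subring),
  and the Sturm-bound form `p ≤ ⌊k/12⌋`.

No named facts; no new definitions.

## References

* [Serre1973] J.-P. Serre, *A Course in Arithmetic*, GTM 7 (1973), Ch. VII §5.4 Cor. 2.
* [Kilford2008] L. J. P. Kilford, *Modular Forms: A Classical and Computational Introduction* (2008), Prop. 6.2, §4.2.3.
* [Edixhoven2011] B. Edixhoven, Ch. 2 of *Computational Aspects of Modular Forms and Galois Representations*,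
  Ann. of Math. Stud. 176 (2011), Thm. 2.5.11.
* [Sturm1987] J. Sturm, *On the congruence of modular forms*, LNM 1240 (1987), Thm. 1.
* [DiamondShurman2005] F. Diamond, J. Shurman, *A First Course in Modular Forms*, GTM 228, Def. 6.5.3, §6.5 (6.12).
-/

noncomputable section

open scoped MatrixGroups ModularForm
open UpperHalfPlane hiding I
open Literature.NumberTheory.EllipticCurves.ModularForms (coeffField coeff_mem_coeffField coeffOrder coeff_mem_coeffOrder
  coeffOrder_le_coeffField)

namespace Literature.NumberTheory.ModularForms

/-! ## §1 The recursion lemma -/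

section Recursion

/-- **The Hecke recursions propagate membership from the primes**: let `a : ℕ → S` satisfy `a(0) = 0`, `a(1) = 1`,
`a(mn) = a(m)a(n)` for coprime `m, n`, and `a(p^{m+2}) = a(p)a(p^{m+1}) − c_p·a(p^m)` for primes `p`. If a subring
`R` contains `a(p)` and `c_p` for every prime `p ≤ N`, then it contains `a(n)` for every `n ≤ N` (write
`n = p^e n'` with `p = minFac n`, `p ∤ n'`).  The ambient ring `S` need not be commutative (e.g. `S = End(S_k)` with
`a(n) = T(n)`). [cite: Serre1973, Ch. VII §5.4 Cor. 2] -/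
theorem Subring.mem_of_prime_le {S : Type*} [Ring S] (R : Subring S) (a c : ℕ → S) (N : ℕ)
    (h0 : a 0 = 0) (h1 : a 1 = 1) (hmul : ∀ m n : ℕ, Nat.Coprime m n → a (m * n) = a m * a n)
    (hrec : ∀ p : ℕ, p.Prime → ∀ m : ℕ, a (p ^ (m + 2)) = a p * a (p ^ (m + 1)) - c p * a (p ^ m))
    (hc : ∀ p : ℕ, p.Prime → p ≤ N → c p ∈ R) (hp : ∀ p : ℕ, p.Prime → p ≤ N → a p ∈ R) {n : ℕ} (hn : n ≤ N) :
    a n ∈ R := by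
  -- prime powers of primes `p ≤ N`, by the three-term recursion
  have hpow : ∀ {p : ℕ}, p.Prime → p ≤ N → ∀ e : ℕ, a (p ^ e) ∈ R ∧ a (p ^ (e + 1)) ∈ R := by
    intro p hpr hpN e
    induction e with
    | zero =>
      rw [pow_zero, zero_add, pow_one, h1]
      exact ⟨one_mem R, hp p hpr hpN⟩
    | succ e ih =>
      refine ⟨ih.2, ?_⟩
      rw [show e + 1 + 1 = e + 2 from rfl, hrec p hpr e]
      exact sub_mem (mul_mem (hp p hpr hpN) ih.2) (mul_mem (hc p hpr hpN) ih.1)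
  induction n using Nat.strong_induction_on with
  | _ n ih =>
    rcases Nat.eq_zero_or_pos n with rfl | hn0
    · rw [h0]
      exact zero_mem R
    rcases eq_or_ne n 1 with rfl | hn1
    · rw [h1]
      exact one_mem R
    have hpr : n.minFac.Prime := Nat.minFac_prime hn1
    obtain ⟨e, n', hnd, hne⟩ := Nat.exists_eq_pow_mul_and_not_dvd hn0.ne' n.minFac hpr.ne_one
    have he : e ≠ 0 := by
      rintro rfl
      rw [pow_zero, one_mul] at hne
      exact hnd (by rw [← hne]; exact Nat.minFac_dvd n)
    have hn'0 : n' ≠ 0 := by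
      rintro rfl
      rw [mul_zero] at hne
      exact hn0.ne' hne
    have hlt : n' < n := by
      rw [hne]
      exact lt_mul_of_one_lt_left (Nat.pos_of_ne_zero hn'0) (Nat.one_lt_pow he hpr.one_lt)
    have hcop : Nat.Coprime (n.minFac ^ e) n' := Nat.Coprime.pow_left e (hpr.coprime_iff_not_dvd.mpr hnd)
    have hpN : n.minFac ≤ N := (Nat.minFac_le hn0).trans hn
    have hmul' : a n = a (n.minFac ^ e) * a n' := by
      conv_lhs => rw [hne]
      exact hmul _ _ hcop
    rw [hmul']
    exact mul_mem (hpow hpr hpN e).1 (ih n' hlt (hlt.le.trans hn))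

end Recursion

variable {k : ℤ}

/-! ## §2 `ℤ[{a_n(f)}] = ℤ[a_p(f) : p prime ≤ B]` and `K_f = ℚ(a_p(f) : p prime ≤ B)` -/

section Order

/-- `p^{k−1}` as a natural-number cast (the weight of a normalized eigenform is `≥ 12`). [cite: Serre1973,
Ch. VII §5.4 Cor. 2] -/
theorem IsNormalizedCuspEigenform.natCast_pow_weight_sub_one {f : CuspForm 𝒮ℒ k} (hf : IsNormalizedCuspEigenform f)
    (p : ℕ) : ((p ^ (k - 1).toNat : ℕ) : ℂ) = (p : ℂ) ^ (k - 1) := by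
  have hk : 0 ≤ k - 1 := by have := hf.twelve_le_weight; omega
  rw [Nat.cast_pow, ← zpow_natCast, Int.toNat_of_nonneg hk]

/-- ★ **`a_n(f) ∈ ℤ[a_p(f) : p prime, p ≤ n]`**: a subring of `ℂ` containing `a_p(f)` for the primes `p ≤ N`
contains `a_n(f)` for all `n ≤ N`. [cite: Serre1973, Ch. VII §5.4 Cor. 2] -/
theorem IsNormalizedCuspEigenform.coeff_mem_of_coeff_prime_le_mem {f : CuspForm 𝒮ℒ k}
    (hf : IsNormalizedCuspEigenform f) {R : Subring ℂ} {N : ℕ}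
    (hR : ∀ p : ℕ, p.Prime → p ≤ N → (qExpansion 1 ⇑f).coeff p ∈ R) {n : ℕ} (hn : n ≤ N) :
    (qExpansion 1 ⇑f).coeff n ∈ R := by
  refine Subring.mem_of_prime_le R (fun m => (qExpansion 1 ⇑f).coeff m) (fun p => ((p ^ (k - 1).toNat : ℕ) : ℂ)) N
    (CuspFormClass.qExpansion_coeff_zero f one_pos one_mem_strictPeriods_SL) hf.2
    (fun m n hmn => hf.coeff_mul_of_coprime hmn) (fun p hp m => ?_) (fun p _ _ => natCast_mem R _) hR hn
  rw [hf.natCast_pow_weight_sub_one, hf.coeff_prime_pow_succ_succ hp m]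

/-- ★ **`ℤ[{a_n(f)}] = ℤ[a_p(f) : p prime, p ≤ B]` for every `B ≥ dim S_k(SL₂(ℤ))`**: the order generated by all
the eigenvalues is generated, as a RING, by the finitely many prime-indexed eigenvalues up to the bound (`a_n`,
`n ≤ B`, is an integer polynomial in the `a_p`, `p ≤ B`, and `ℤ[{a_n}] = ℤa_1 + ⋯ + ℤa_B`).
[cite: Serre1973, Ch. VII §5.4 Cor. 2] [cite: DiamondShurman2005, §6.5 (6.12)] [cite: Edixhoven2011, Thm. 2.5.11] -/
theorem coeffOrder_eq_adjoin_primes_le {f : CuspForm 𝒮ℒ k} (hf : IsNormalizedCuspEigenform f) {B : ℕ}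
    (hB : Module.finrank ℂ (CuspForm 𝒮ℒ k) ≤ B) :
    coeffOrder f = Algebra.adjoin ℤ ((fun p : ℕ => (qExpansion 1 ⇑f).coeff p) '' {p : ℕ | p.Prime ∧ p ≤ B}) := by
  apply le_antisymm
  · intro x hx
    have hx' : x ∈ Subalgebra.toSubmodule (coeffOrder f) := hx
    rw [coeffOrder_toSubmodule_eq_span hf hB] at hx'
    refine (Submodule.span_le.mpr ?_ :
      Submodule.span ℤ ((fun n : ℕ => (qExpansion 1 ⇑f).coeff n) '' Set.Icc 1 B) ≤
        Subalgebra.toSubmodule (Algebra.adjoin ℤ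
          ((fun p : ℕ => (qExpansion 1 ⇑f).coeff p) '' {p : ℕ | p.Prime ∧ p ≤ B}))) hx'
    rintro _ ⟨n, hn, rfl⟩
    exact hf.coeff_mem_of_coeff_prime_le_mem
      (R := (Algebra.adjoin ℤ ((fun p : ℕ => (qExpansion 1 ⇑f).coeff p) '' {p : ℕ | p.Prime ∧ p ≤ B})).toSubring)
      (fun p hp hpB => Algebra.subset_adjoin ⟨p, ⟨hp, hpB⟩, rfl⟩) hn.2
  · exact Algebra.adjoin_le fun x hx => by
      obtain ⟨p, -, rfl⟩ := hx
      exact coeff_mem_coeffOrder f p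

/-- ★ **`K_f = ℚ(a_p(f) : p prime, p ≤ B)` for every `B ≥ dim S_k(SL₂(ℤ))`.** [cite: Serre1973, Ch. VII §5.4
Cor. 2] [cite: DiamondShurman2005, Def. 6.5.3] [cite: Kilford2008, §4.2.3] -/
theorem coeffField_eq_adjoin_primes_le {f : CuspForm 𝒮ℒ k} (hf : IsNormalizedCuspEigenform f) {B : ℕ}
    (hB : Module.finrank ℂ (CuspForm 𝒮ℒ k) ≤ B) :
    coeffField f = IntermediateField.adjoin ℚ ((fun p : ℕ => (qExpansion 1 ⇑f).coeff p) '' {p : ℕ | p.Prime ∧ p ≤ B}) := by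
  apply le_antisymm
  · rw [coeffField_eq_adjoin_image_Icc hf hB, IntermediateField.adjoin_le_iff]
    rintro _ ⟨n, hn, rfl⟩
    exact hf.coeff_mem_of_coeff_prime_le_mem
      (R := (IntermediateField.adjoin ℚ
        ((fun p : ℕ => (qExpansion 1 ⇑f).coeff p) '' {p : ℕ | p.Prime ∧ p ≤ B})).toSubfield.toSubring)
      (fun p hp hpB => IntermediateField.subset_adjoin ℚ _ ⟨p, ⟨hp, hpB⟩, rfl⟩) hn.2
  · exact IntermediateField.adjoin_le_iff.mpr fun x hx => by
      obtain ⟨p, -, rfl⟩ := hx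
      exact coeff_mem_coeffField f p

/-- **`K_f = ℚ(a_p(f) : p prime, p ≤ ⌊k/12⌋)`** (Sturm-bound form). [cite: Serre1973, Ch. VII §5.4 Cor. 2]
[cite: Edixhoven2011, Thm. 2.5.11] -/
theorem coeffField_eq_adjoin_primes_le_sturm {f : CuspForm 𝒮ℒ k} (hf : IsNormalizedCuspEigenform f) :
    coeffField f =
      IntermediateField.adjoin ℚ ((fun p : ℕ => (qExpansion 1 ⇑f).coeff p) '' {p : ℕ | p.Prime ∧ p ≤ k.toNat / 12}) :=
  coeffField_eq_adjoin_primes_le hf (finrank_cuspForm_le_weight_div_twelve k)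

end Order

/-! ## §3 Two eigenforms with the same `a_p`, `p ≤ dim S_k` prime, are equal -/

section Determination

/-- **If `a_p(f) = a_p(g)` for the primes `p ≤ N` then `a_n(f) = a_n(g)` for all `n ≤ N`** (two normalized
eigenforms of the same weight: the recursion lemma in `ℂ × ℂ` for the diagonal subring). [cite: Serre1973, Ch. VII
§5.4 Cor. 2] -/
theorem IsNormalizedCuspEigenform.coeff_eq_of_coeff_prime_eq_le {f g : CuspForm 𝒮ℒ k}
    (hf : IsNormalizedCuspEigenform f) (hg : IsNormalizedCuspEigenform g) {N : ℕ}
    (hfg : ∀ p : ℕ, p.Prime → p ≤ N → (qExpansion 1 ⇑f).coeff p = (qExpansion 1 ⇑g).coeff p) {n : ℕ} (hn : n ≤ N) :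
    (qExpansion 1 ⇑f).coeff n = (qExpansion 1 ⇑g).coeff n := by
  have h := Subring.mem_of_prime_le ((RingHom.fst ℂ ℂ).eqLocus (RingHom.snd ℂ ℂ))
    (fun m => ((qExpansion 1 ⇑f).coeff m, (qExpansion 1 ⇑g).coeff m))
    (fun p => (((p ^ (k - 1).toNat : ℕ) : ℂ), ((p ^ (k - 1).toNat : ℕ) : ℂ))) N
    (Prod.ext (CuspFormClass.qExpansion_coeff_zero f one_pos one_mem_strictPeriods_SL)
      (CuspFormClass.qExpansion_coeff_zero g one_pos one_mem_strictPeriods_SL))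
    (Prod.ext hf.2 hg.2)
    (fun m n hmn => Prod.ext (hf.coeff_mul_of_coprime hmn) (hg.coeff_mul_of_coprime hmn))
    (fun p hp m => Prod.ext
      (by rw [Prod.fst_sub, Prod.fst_mul, Prod.fst_mul, hf.natCast_pow_weight_sub_one, hf.coeff_prime_pow_succ_succ hp m])
      (by rw [Prod.snd_sub, Prod.snd_mul, Prod.snd_mul, hg.natCast_pow_weight_sub_one, hg.coeff_prime_pow_succ_succ hp m]))
    (fun p _ _ => rfl) (fun p hp hpN => hfg p hp hpN) hn
  exact h

/-- ★ **Two normalized eigenforms of `S_k(SL₂(ℤ))` with `a_p(f) = a_p(g)` for the primes `p ≤ dim S_k` are equal**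
(hence have the same eigenvalue for every Hecke operator): the `a_n`, `n ≤ dim S_k`, are determined by these `a_p`,
and they determine the form (`IsNormalizedCuspEigenform.eq_of_coeff_eq_le_finrank`). [cite: Serre1973, Ch. VII
§5.4 Cor. 2] [cite: Kilford2008, Prop. 6.2] [cite: Sturm1987, Thm. 1] -/
theorem IsNormalizedCuspEigenform.eq_of_coeff_prime_eq_le_finrank {f g : CuspForm 𝒮ℒ k}
    (hf : IsNormalizedCuspEigenform f) (hg : IsNormalizedCuspEigenform g)
    (hfg : ∀ p : ℕ, p.Prime → p ≤ Module.finrank ℂ (CuspForm 𝒮ℒ k) →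
      (qExpansion 1 ⇑f).coeff p = (qExpansion 1 ⇑g).coeff p) : f = g :=
  hf.eq_of_coeff_eq_le_finrank hg fun _ _ hle => hf.coeff_eq_of_coeff_prime_eq_le hg hfg hle

/-- **Sturm-bound form**: `a_p(f) = a_p(g)` for the primes `p ≤ ⌊k/12⌋` implies `f = g`. [cite: Sturm1987, Thm. 1]
[cite: Serre1973, Ch. VII §5.4 Cor. 2] -/
theorem IsNormalizedCuspEigenform.eq_of_coeff_prime_eq_le_sturm {f g : CuspForm 𝒮ℒ k}
    (hf : IsNormalizedCuspEigenform f) (hg : IsNormalizedCuspEigenform g)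
    (hfg : ∀ p : ℕ, p.Prime → p ≤ k.toNat / 12 → (qExpansion 1 ⇑f).coeff p = (qExpansion 1 ⇑g).coeff p) : f = g :=
  hf.eq_of_coeff_prime_eq_le_finrank hg fun p hp hle =>
    hfg p hp (hle.trans (finrank_cuspForm_le_weight_div_twelve k))

/-- ★ **`f = g ↔ a_p(f) = a_p(g)` for all primes `p ≤ dim S_k`.** [cite: Kilford2008, Prop. 6.2 and §4.2.3]
[cite: Serre1973, Ch. VII §5.4 Cor. 2] -/
theorem IsNormalizedCuspEigenform.eq_iff_coeff_prime_eq_le_finrank {f g : CuspForm 𝒮ℒ k}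
    (hf : IsNormalizedCuspEigenform f) (hg : IsNormalizedCuspEigenform g) :
    f = g ↔ ∀ p : ℕ, p.Prime → p ≤ Module.finrank ℂ (CuspForm 𝒮ℒ k) →
      (qExpansion 1 ⇑f).coeff p = (qExpansion 1 ⇑g).coeff p :=
  ⟨fun h _ _ _ => by rw [h], hf.eq_of_coeff_prime_eq_le_finrank hg⟩

/-- **Congruence version**: if `a_p(f) − a_p(g) ∈ 𝔞` for the primes `p ≤ N`, for an ideal-like subring condition —
here: a subring `R ⊆ ℂ` containing `a_p(f)` and `a_p(g)` for `p ≤ N` contains all `a_n(f)`, `a_n(g)`, `n ≤ N`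
(so congruences between the `a_p` modulo an ideal of `R` propagate inside `R`). [cite: Serre1973, Ch. VII §5.4
Cor. 2] [cite: Sturm1987, Thm. 1] -/
theorem IsNormalizedCuspEigenform.coeff_mem_and_coeff_mem_of_prime_le {f g : CuspForm 𝒮ℒ k}
    (hf : IsNormalizedCuspEigenform f) (hg : IsNormalizedCuspEigenform g) {R : Subring ℂ} {N : ℕ}
    (hR : ∀ p : ℕ, p.Prime → p ≤ N → (qExpansion 1 ⇑f).coeff p ∈ R ∧ (qExpansion 1 ⇑g).coeff p ∈ R) {n : ℕ}
    (hn : n ≤ N) : (qExpansion 1 ⇑f).coeff n ∈ R ∧ (qExpansion 1 ⇑g).coeff n ∈ R :=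
  ⟨hf.coeff_mem_of_coeff_prime_le_mem (fun p hp hpN => (hR p hp hpN).1) hn,
    hg.coeff_mem_of_coeff_prime_le_mem (fun p hp hpN => (hR p hp hpN).2) hn⟩

end Determination

end Literature.NumberTheory.ModularForms
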